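import Mathlib
import Summits.Ventures.HodgeRepro2.T5PadicLocalField
import Summits.Ventures.HodgeRepro2.T5LocalRingGaussSum

/-!
# `ℤ_p/(p^n) = ℤ/p^nℤ`: the finite local ring `R = O_w/𝔭_w^c` of §AA.1(b) on Mathlib's `ℚ_p`

Blind cell `pub-hodge-repro2`, seat p7 (gen 9), Tier-5 kernel support for N5 / §G [R-4]
(route/T5-route-3.md §AA.1(b)(i)–(ii): «`O_w = ℤ_p` (deg 𝔭 = 1, S0 / J.1), so `R := O_w/𝔭_w^c =
ℤ/p^cℤ` is a finite commutative local ring with `𝔪 = pℤ/p^cℤ` … `χ` is `IsPrimitiveChar` …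
`ψ̄` is `AddChar.IsPrimitive`»).

With `𝒪[ℚ_[p]] = ℤ_[p]` (`T5PadicLocalField`, p395657) and Mathlib's `PadicInt.toZModPow`
(kernel `(p^n)`):

* `padicIntQuotEquiv`: `ℤ_[p] ⧸ (p^n) ≃+* ZMod (p^n)`;
* `quotEquivZMod`: `𝒪[ℚ_[p]] ⧸ (p^n) ≃+* ZMod (p^n)` — the ring `R` of the Gauss-sum files
  (`T5LocalRingGaussSum`, `T5DVRQuotientModel`, …) at the datum's place IS `ℤ/p^nℤ`;
* `card_quot`: `|𝒪[ℚ_p]/(p^n)| = p^n` (agreeing with `T5DVRQuotientCard.card_quot_span_pow`);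
* `isLocalRing_zmod_pow`: `ZMod (p^(m+1))` is a local ring (transported from `isLocalRing_quot`),
  and `gNorm_mul_gNorm_inv_zmod`: the (T1) Gauss-sum identity
  `𝔤(χ, ψ) 𝔤(χ⁻¹, ψ) = χ(−1)` for a primitive `χ` of `ℤ/p^{m+1}ℤ` (`IsPrimitiveChar`) against a
  primitive additive character — row 18's theorem on the explicit ring `ℤ/p^cℤ`.

README §8(d): uses an L-value-free non-vanishing device: NO.
-/

namespace Summit.Ventures.HodgeRepro2.T5PadicQuotientZMod

open scoped NormedField Valued
open Ideal

variable (p : ℕ) [Fact p.Prime]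

/-- `ℤ_p ⧸ (p^n) ≃+* ℤ/p^nℤ` (Mathlib's `PadicInt.toZModPow`, kernel `(p^n)`, surjective). -/
noncomputable def padicIntQuotEquiv (n : ℕ) :
    ℤ_[p] ⧸ Ideal.span {(p : ℤ_[p]) ^ n} ≃+* ZMod (p ^ n) :=
  (Ideal.quotEquivOfEq (PadicInt.ker_toZModPow n).symm).trans
    (RingHom.quotientKerEquivOfSurjective (ZMod.ringHom_surjective (PadicInt.toZModPow n)))

/-- The ideal `(p^n)` of `𝒪[ℚ_p]` maps onto the ideal `(p^n)` of `ℤ_p` under `integerEquiv`. -/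
theorem map_span_pow (n : ℕ) :
    Ideal.span {(p : ℤ_[p]) ^ n} =
      (Ideal.span {((p : ℕ) : 𝒪[ℚ_[p]]) ^ n}).map
        (T5PadicLocalField.integerEquiv p : 𝒪[ℚ_[p]] →+* ℤ_[p]) := by
  rw [Ideal.map_span, Set.image_singleton, map_pow, map_natCast]

/-- `𝒪[ℚ_p] ⧸ (p^n) ≃+* ℤ/p^nℤ`: the finite local ring `R` of the Gauss-sum files at the
datum's degree-one place is `ℤ/p^cℤ`. -/
noncomputable def quotEquivZMod (n : ℕ) :
    𝒪[ℚ_[p]] ⧸ Ideal.span {((p : ℕ) : 𝒪[ℚ_[p]]) ^ n} ≃+* ZMod (p ^ n) :=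
  (Ideal.quotientEquiv _ _ (T5PadicLocalField.integerEquiv p) (map_span_pow p n)).trans
    (padicIntQuotEquiv p n)

/-- `|𝒪[ℚ_p] ⧸ (p^n)| = p^n`. -/
theorem card_quot (n : ℕ) :
    Nat.card (𝒪[ℚ_[p]] ⧸ Ideal.span {((p : ℕ) : 𝒪[ℚ_[p]]) ^ n}) = p ^ n := by
  rw [Nat.card_congr (quotEquivZMod p n).toEquiv, Nat.card_zmod]

/-- The quotient `𝒪[ℚ_p] ⧸ (p^n)` is finite. -/
instance finite_quot (n : ℕ) : Finite (𝒪[ℚ_[p]] ⧸ Ideal.span {((p : ℕ) : 𝒪[ℚ_[p]]) ^ n}) :=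
  Finite.of_equiv _ (quotEquivZMod p n).symm.toEquiv

/-- Consistency with the abstract count: `|𝒪[ℚ_p]/(p^n)| = |𝓀[ℚ_p]|^n = p^n`. -/
theorem card_quot_eq_card_residueField_pow (n : ℕ) :
    Nat.card (𝒪[ℚ_[p]] ⧸ Ideal.span {((p : ℕ) : 𝒪[ℚ_[p]]) ^ n}) = Nat.card 𝓀[ℚ_[p]] ^ n := by
  rw [card_quot, T5PadicLocalField.card_residueField]

/-- `ℤ/p^{m+1}ℤ` is a local ring (transported from `T5DVRQuotientModel.isLocalRing_quot`). -/
theorem isLocalRing_zmod_pow (m : ℕ) : IsLocalRing (ZMod (p ^ (m + 1))) :=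
  haveI : IsLocalRing (𝒪[ℚ_[p]] ⧸ Ideal.span {((p : ℕ) : 𝒪[ℚ_[p]]) ^ (m + 1)}) :=
    T5DVRQuotientModel.isLocalRing_quot (T5PadicLocalField.irreducible_p p)
  (quotEquivZMod p (m + 1)).isLocalRing

/-- **(T1)'s Gauss-sum identity on `ℤ/p^{m+1}ℤ`**: `𝔤(χ, ψ) 𝔤(χ⁻¹, ψ) = χ(−1)` for a primitive
multiplicative character `χ` (non-trivial on `1 + p^m ℤ/p^{m+1}ℤ` — `IsPrimitiveChar`) and a
primitive additive character `ψ` (row 18's `gNorm_mul_gNorm_inv` on the explicit ring `R = ℤ/p^cℤ`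
of §AA.1(b)). -/
theorem gNorm_mul_gNorm_inv_zmod (m : ℕ) {χ : MulChar (ZMod (p ^ (m + 1))) ℂ}
    (hχ : T5LocalRingGaussSum.IsPrimitiveChar χ) {ψ : AddChar (ZMod (p ^ (m + 1))) ℂ}
    (hψ : ψ.IsPrimitive) :
    T5LocalRingGaussSum.gNorm χ ψ * T5LocalRingGaussSum.gNorm χ⁻¹ ψ = χ (-1) :=
  haveI := isLocalRing_zmod_pow p m
  T5LocalRingGaussSum.gNorm_mul_gNorm_inv hχ hψ

end Summit.Ventures.HodgeRepro2.T5PadicQuotientZMod
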